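import Summits.ValiantsHypothesis.ValiantsHypothesis.Theorems.BarrierLeverChowHitsPartitionMinorsRHybridArrow

/-!
# Route BarrierLever — item `ChowHitsPartitionMinorsR` (stmt-ValiantsHypothesis-21882):
# THEOREM H under VERTEX RELABELLING — `m(R, C) ≤ h + ‖π(C) ∖ R‖` for every permutation `π` of the vertices

Helper file (`--supports stmt-ValiantsHypothesis-21882`; cell valiant-natproofs, rung V4, 𝒟-side support item of route
BarrierLever; prover seat val-np-p5 gen 32; seat memo MEMO-21882-valnp5-g32.md §6 remark). Closes NO item.

The base forms of the hybrid design identify `x_a` with `y_a`; renaming the `y`-variables by a permutation `π` of `Fin h`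
(`rename` is a ring automorphism preserving total degree) transports a witness for the relabelled layout
`(u, π ∘ w)` to one for `(u, w)` (`chow_hit_relabel_fin`, pattern of `ChowFacePrivate.chow_hit_swap_fin`). Hence
(`chowHits_of_hybrid_relabel`): for EVERY vertex permutation `π`, the layout `(u, w)` is hit by
`h + Σ_{j : π(w j) ∉ range u} |w j|` affine forms — the defect is measured after the best identification of the two vertex sets.

WHAT THIS IS NOT: item 21882 is NOT proved; nothing on crux stmt-ValiantsHypothesis-14610 or on `VP` versus `VNP`.
-/

set_option linter.dupNamespace false

namespace Summit.ValiantsHypothesis.ValiantsHypothesis.Theorems.BarrierLever.ChowHybrid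

open Finset MvPolynomial

noncomputable section

variable {h r : ℕ}

/-- The variable permutation fixing the `x`-block and acting by `π` on the `y`-block. -/
def yPerm (π : Equiv.Perm (Fin h)) : Equiv.Perm (Fin (h + h)) :=
  finSumFinEquiv.symm.trans ((Equiv.sumCongr (Equiv.refl (Fin h)) π).trans finSumFinEquiv)

/-- `yPerm π` fixes `x_a`. -/
theorem yPerm_castAdd (π : Equiv.Perm (Fin h)) (a : Fin h) : yPerm π (Fin.castAdd h a) = Fin.castAdd h a := by
  rw [yPerm, Equiv.trans_apply, Equiv.trans_apply, finSumFinEquiv_symm_apply_castAdd, Equiv.sumCongr_apply,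
    Sum.map_inl, finSumFinEquiv_apply_left]
  rfl

/-- `yPerm π` sends `y_c` to `y_{π c}`. -/
theorem yPerm_natAdd (π : Equiv.Perm (Fin h)) (c : Fin h) : yPerm π (Fin.natAdd h c) = Fin.natAdd h (π c) := by
  rw [yPerm, Equiv.trans_apply, Equiv.trans_apply, finSumFinEquiv_symm_apply_natAdd, Equiv.sumCongr_apply,
    Sum.map_inr, finSumFinEquiv_apply_right]

/-- The partition exponent of `(V, W)` is mapped to that of `(V, π W)`. -/
theorem mapDomain_yPerm_partitionExpo (π : Equiv.Perm (Fin h)) (V W : Finset (Fin h)) :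
    Finsupp.mapDomain (yPerm π)
      (∑ a ∈ V, Finsupp.single (Fin.castAdd h a) 1 + ∑ c ∈ W, Finsupp.single (Fin.natAdd h c) 1 : Fin (h + h) →₀ ℕ) =
      ∑ a ∈ V, Finsupp.single (Fin.castAdd h a) 1 + ∑ c ∈ W.map π.toEmbedding, Finsupp.single (Fin.natAdd h c) 1 := by
  classical
  rw [Finsupp.mapDomain_add, Finsupp.mapDomain_finsetSum, Finsupp.mapDomain_finsetSum]
  congr 1
  · refine Finset.sum_congr rfl fun a _ => ?_
    rw [Finsupp.mapDomain_single, yPerm_castAdd]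
  · rw [Finset.sum_map]
    refine Finset.sum_congr rfl fun c _ => ?_
    rw [Finsupp.mapDomain_single, yPerm_natAdd]
    rfl

/-- **Relabelling the `y`-vertices.** If the layout `(u, π ∘ w)` is hit by `m` affine forms, so is `(u, w)`. -/
theorem chow_hit_relabel_fin {m : ℕ} (π : Equiv.Perm (Fin h)) (u w : Fin r → Finset (Fin h))
    (hhit : ∃ ℓ : Fin m → MvPolynomial (Fin (h + h)) ℂ, (∀ q, (ℓ q).totalDegree ≤ 1) ∧
      (Matrix.of fun i j : Fin r => coeff
        (∑ b ∈ u i, Finsupp.single (Fin.castAdd h b) 1 +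
          ∑ d ∈ (w j).map π.toEmbedding, Finsupp.single (Fin.natAdd h d) 1) (∏ q, ℓ q)).det ≠ 0) :
    ∃ ℓ : Fin m → MvPolynomial (Fin (h + h)) ℂ, (∀ q, (ℓ q).totalDegree ≤ 1) ∧
      (Matrix.of fun i j : Fin r => coeff
        (∑ b ∈ u i, Finsupp.single (Fin.castAdd h b) 1 + ∑ d ∈ w j, Finsupp.single (Fin.natAdd h d) 1)
        (∏ q, ℓ q)).det ≠ 0 := by
  classical
  obtain ⟨ℓ, hdeg, hdet⟩ := hhit
  refine ⟨fun q => rename (yPerm π).symm (ℓ q), fun q => (totalDegree_rename_le _ _).trans (hdeg q), ?_⟩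
  have hprod : (∏ q, rename (yPerm π).symm (ℓ q)) = rename (yPerm π).symm (∏ q, ℓ q) := by rw [map_prod]
  have hM : (Matrix.of fun i j : Fin r => coeff
      (∑ b ∈ u i, Finsupp.single (Fin.castAdd h b) 1 + ∑ d ∈ w j, Finsupp.single (Fin.natAdd h d) 1)
      (∏ q, rename (yPerm π).symm (ℓ q))) =
      (Matrix.of fun i j : Fin r => coeff
        (∑ b ∈ u i, Finsupp.single (Fin.castAdd h b) 1 +
          ∑ d ∈ (w j).map π.toEmbedding, Finsupp.single (Fin.natAdd h d) 1) (∏ q, ℓ q)) := by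
    ext i j
    rw [Matrix.of_apply, Matrix.of_apply, hprod]
    -- `coeff_d (rename ψ F) = coeff_{mapDomain ψ⁻¹… }`: write `E (u i) (w j) = mapDomain ψ (E (u i) (π w j))` with `ψ = (yPerm π)⁻¹`
    have key : (∑ b ∈ u i, Finsupp.single (Fin.castAdd h b) 1 + ∑ d ∈ w j, Finsupp.single (Fin.natAdd h d) 1 :
        Fin (h + h) →₀ ℕ) = Finsupp.mapDomain (yPerm π).symm
        (∑ b ∈ u i, Finsupp.single (Fin.castAdd h b) 1 +
          ∑ d ∈ (w j).map π.toEmbedding, Finsupp.single (Fin.natAdd h d) 1) := by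
      rw [← mapDomain_yPerm_partitionExpo π (u i) (w j), ← Finsupp.mapDomain_comp]
      simp only [Equiv.symm_comp_self, Finsupp.mapDomain_id]
    rw [key, coeff_rename_mapDomain _ (yPerm π).symm.injective]
  rw [hM]
  exact hdet

/-- The image of a lower-set family under a vertex permutation is a lower-set family. -/
theorem isLowerSet_range_map (π : Equiv.Perm (Fin h)) (w : Fin r → Finset (Fin h))
    (hlw : IsLowerSet (Set.range w)) : IsLowerSet (Set.range fun j => (w j).map π.toEmbedding) := by
  classical
  rintro W V hVW ⟨j, rfl⟩
  -- `V ⊆ π (w j)`: pull back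
  have hsub : V.map π.symm.toEmbedding ⊆ w j := by
    intro x hx
    rw [Finset.mem_map] at hx
    obtain ⟨y, hy, rfl⟩ := hx
    have hy' : y ∈ (w j).map π.toEmbedding := hVW hy
    rw [Finset.mem_map] at hy'
    obtain ⟨z, hz, rfl⟩ := hy'
    simpa using hz
  obtain ⟨k, hk⟩ := hlw (show V.map π.symm.toEmbedding ≤ w j from hsub) ⟨j, rfl⟩
  refine ⟨k, ?_⟩
  show (w k).map π.toEmbedding = V
  rw [hk, Finset.map_map]
  convert Finset.map_refl (s := V) using 2
  ext x
  simp

/-- Relabelled columns stay injective. -/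
theorem injective_map (π : Equiv.Perm (Fin h)) (w : Fin r → Finset (Fin h)) (hw : Function.Injective w) :
    Function.Injective fun j => (w j).map π.toEmbedding :=
  fun _ _ e => hw (Finset.map_injective π.toEmbedding e)

/-- **THEOREM H UNDER RELABELLING.** For every vertex permutation `π`, the lower-set layout `(u, w)` is hit by `M` affine
forms for every `M ≥ h + ‖π(C) ∖ R‖` (the column defect mass measured after relabelling the columns by `π`). -/
theorem chowHits_of_hybrid_relabel {M : ℕ} (π : Equiv.Perm (Fin h)) (u w : Fin r → Finset (Fin h))
    (hu : Function.Injective u) (hw : Function.Injective w) (hlu : IsLowerSet (Set.range u))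
    (hlw : IsLowerSet (Set.range w))
    (hM : h + colDefectMass u (fun j => (w j).map π.toEmbedding) ≤ M) :
    ∃ ℓ : Fin M → MvPolynomial (Fin (h + h)) ℂ, (∀ k, (ℓ k).totalDegree ≤ 1) ∧
      (Matrix.of fun i j : Fin r => MvPolynomial.coeff (∑ a ∈ u i, Finsupp.single (Fin.castAdd h a) 1 +
          ∑ c ∈ w j, Finsupp.single (Fin.natAdd h c) 1) (∏ k, ℓ k)).det ≠ 0 :=
  chow_hit_relabel_fin π u w
    (chowHits_of_hybrid_le u (fun j => (w j).map π.toEmbedding) hu (injective_map π w hw) hlu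
      (isLowerSet_range_map π w hlw) hM)

/-- **THEOREM H UNDER RELABELLING, swapped.** For every vertex permutation `π`, `M ≥ h + ‖R ∖ π(C)‖` suffices too. -/
theorem chowHits_of_hybrid_swap_relabel {M : ℕ} (π : Equiv.Perm (Fin h)) (u w : Fin r → Finset (Fin h))
    (hu : Function.Injective u) (hw : Function.Injective w) (hlu : IsLowerSet (Set.range u))
    (hlw : IsLowerSet (Set.range w))
    (hM : h + colDefectMass (fun j => (w j).map π.toEmbedding) u ≤ M) :
    ∃ ℓ : Fin M → MvPolynomial (Fin (h + h)) ℂ, (∀ k, (ℓ k).totalDegree ≤ 1) ∧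
      (Matrix.of fun i j : Fin r => MvPolynomial.coeff (∑ a ∈ u i, Finsupp.single (Fin.castAdd h a) 1 +
          ∑ c ∈ w j, Finsupp.single (Fin.natAdd h c) 1) (∏ k, ℓ k)).det ≠ 0 :=
  chow_hit_relabel_fin π u w
    (chowHits_of_hybrid_swap_le u (fun j => (w j).map π.toEmbedding) hu (injective_map π w hw) hlu
      (isLowerSet_range_map π w hlw) hM)

/-- **Inside the lower-set budget, after relabelling**: if for SOME vertex permutation `π` one of the two relabelled
defect masses is `≤ h·h − 3h`, the pair is hit within `m + 2h ≤ h·h`. -/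
theorem exists_chow_of_small_defect_relabel (u w : Fin r → Finset (Fin h)) (hu : Function.Injective u)
    (hw : Function.Injective w) (hlu : IsLowerSet (Set.range u)) (hlw : IsLowerSet (Set.range w))
    (hsmall : ∃ π : Equiv.Perm (Fin h), h + colDefectMass u (fun j => (w j).map π.toEmbedding) + 2 * h ≤ h * h ∨
      h + colDefectMass (fun j => (w j).map π.toEmbedding) u + 2 * h ≤ h * h) :
    ∃ m : ℕ, m + 2 * h ≤ h * h ∧ ∃ ℓ : Fin m → MvPolynomial (Fin (h + h)) ℂ,
      (∀ k, (ℓ k).totalDegree ≤ 1) ∧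
      (Matrix.of fun i j : Fin r => MvPolynomial.coeff
        (∑ a ∈ u i, Finsupp.single (Fin.castAdd h a) 1 +
          ∑ c ∈ w j, Finsupp.single (Fin.natAdd h c) 1) (∏ k, ℓ k)).det ≠ 0 := by
  obtain ⟨π, h1 | h2⟩ := hsmall
  · exact ⟨_, h1, chowHits_of_hybrid_relabel π u w hu hw hlu hlw le_rfl⟩
  · exact ⟨_, h2, chowHits_of_hybrid_swap_relabel π u w hu hw hlu hlw le_rfl⟩

end

end Summit.ValiantsHypothesis.ValiantsHypothesis.Theorems.BarrierLever.ChowHybrid
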